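import Literature.NumberTheory.LFunctions.Zhang2022.Section3Lemma36Holds
import Literature.NumberTheory.LFunctions.Zhang2022.RepairGapLemma32FlatScaleLaw
import HarnessLib

/-!
# Zhang (2022), rescue GAP/REQSIDE (D-0124 (4)–(5)): the SCALE LAW of Lemma 3.6 — under
# `‖L(1,χ)‖ ≤ 𝓛^{−(k+15)}` the input `∑ς²/n` is `≪ 𝓛^{−k}` and (3.6) at threshold `𝓛^{−τ}` fails for at
# most `O(𝔓𝓛^{2+2τ−k})` characters `ψ ∈ Ψ` (printed `k = 2007`, `τ = 633`: `𝔓𝓛^{−739}`)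

Topic `Literature/NumberTheory/LFunctions/Zhang2022` (Landau–Siegel audit tree; verdict-neutral).
Y. Zhang, *Discrete mean estimates and the Landau–Siegel zero*, arXiv:2211.02515v1 (2022)
[Zhang2022LandauSiegel] — **an unrefereed manuscript under adjudication; nothing in this file asserts or
denies its Theorems 1–2, and nothing here is a claim about Landau–Siegel zeros. The programme SEARCHES and
TYPES; no claim about Landau–Siegel zeros, Theorems 1–2 of arXiv:2211.02515 or a repaired Margin232 until a
kernel theorem says so.**

Lemma 3.6 (§3 p. 7 / p. 16: "Assume that (A) holds. The inequality (3.6)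
`|X₄(D⁸,ψ)| + ∫_{D⁴}^{D⁸}|X₄(x,ψ)| dx/x < 𝓛^{−633}` holds for all but at most `O(𝔓𝓛^{−739})` characters
`ψ ∈ Ψ`") is the tree theorem `Skeleton.lemma36_holds` (file `Section3Lemma36Holds`) over
`Lemma36.lemma_3_6` (orthogonality since `p ∼ P > D⁸`, Cauchy–Schwarz in `dx/x`, Chebyshev; second moment
`≤ 34𝓛²·𝔓·E`, `E = ∑_{D⁴<n≤D⁸}ς(n)²/n`, `Lemma36.lemma_3_6_of_input`) and the subconvexity-free input
`E ≤ C𝓛^{−2007}` (`Lemma36Input.lemma_3_6_input`: elementary reduction `E ≤ 4(1+log D⁴)⁸·∑ν²d/n` + Lemma 3.2♭).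
The rescue's exponent budget (kit LP-3 j271838; `Repair.Gap.ExpTuple`, `RepairGapExponentBudget`) carries the
step as the DESK READINGS «`s₂ = E − 15`» (the input) and «`e₄ = (s₂ − 2) − 2τ₄`» (the count) — the second S0
binding chain `e₄ ≥ e_req` (`E_min(S0) = 2000`). This file DERIVES both from the tree's proofs with the exponents free:

* `lemma36Input_scale_of_norm_le` — `∑_{D⁴<n≤D⁸} ς(n)²/n ≤ C(k)𝓛^{−k}` for `log D ≥ 3`, `χ` primitive quadratic
  with `‖L(1,χ)‖ ≤ 𝓛^{−(k+15)}` (`Repair.Gap.lemma32Flat_scale_of_norm_le (k+8)` × `4·5⁸𝓛⁸`): the reading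
  `s₂ = E − 15` along the tree's route;
* `lemma36_scale_of_norm_le` — for natural `k`, `τ`: the number of `ψ ∈ Ψ` with
  `|X₄(D⁸,ψ)| + ∫_{D⁴}^{D⁸}|X₄| dx/x ≥ 𝓛^{−τ}` is `≤ C(k)·𝔓·𝓛^{2+2τ}/𝓛^{k}` (`log D ≥ 3`, same premise): the
  reading `e₄ = (s₂ − 2) − 2τ₄`;
* `lemma36_scale_of_assumptionAWith` — the `ForAllLarge` form from `Repair.Bed.AssumptionAWith E`, every real
  `E ≥ k + 15`;
* `not_ineq36_count_of_assumptionAWith` — at the printed threshold `τ = 633` (the skeleton's `Ineq36`):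
  `#{ψ ∈ Ψ : ¬(3.6)} ≤ C·𝔓·𝓛^{1268}/𝓛^{k}` under `AssumptionAWith E`, `E ≥ k + 15` (the typed node
  `Skeleton.Lemma36` = `C𝔓𝓛^{−739}` is exactly `k = 2007`, `E ≥ 2022` — the printed exponent with NO slack on this
  route; not restated).

READING (GAP G-31 / REQSIDE (5), as-typed): with the three scale laws `RepairGapLemma31ScaleLaw` (s₁),
`RepairGapLemma35ScaleLaw` (e₃), this file (s₂, e₄) and `RepairGapLemma58ScaleLaw` (Lemma 5.8), every
(A)-exponent coefficient of the located budget `Repair.Gap.ExpTuple.budget` is a theorem about `L`-functions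
(SUFFICIENCY along the tree's routes): from (A) at exponent `E`, Lemma 3.5 leaves `O(𝔓𝓛^{−(E−106−2τ₃)})` and
Lemma 3.6 `O(𝔓𝓛^{−(E−17−2τ₄)})` exceptions (desk: `E − 113 − 2τ₃`, `E − 17 − 2τ₄`). Where `≥ e_req` is consumed
(Prop. 2.1, (7.5)) is not this file's subject. Theorems only; no definition, no named fact; nothing about (A).

## References

* Y. Zhang, arXiv:2211.02515v1 (2022), §3 Lemmas 3.2, 3.3 (i), 3.6 (pp. 7, 16); §2 (2.9); Assumption (A) p. 4.
  [cite: Zhang2022LandauSiegel, §3, Lemma 3.6]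
-/

noncomputable section

open Complex Real Finset MeasureTheory ArithmeticFunction

namespace Literature.NumberTheory.LFunctions.Zhang2022.Repair.Gap

open Literature.NumberTheory.LFunctions.Zhang2022 (sigmaTrunc nuOf upsilonOf
  sum_sigma_sq_div_le_source_log_pow frakP)
open Literature.NumberTheory.LFunctions.Zhang2022.Skeleton
open Literature.NumberTheory.LFunctions.Zhang2022.Lemma36Input (reChar_mul_all nuOf_reChar_sq_eq)
open Literature.NumberTheory.LFunctions.DirichletAbel (reChar reChar_one abs_reChar_le_one)
open Literature.NumberTheory.LFunctions.Zhang2022.Repair.Bed (AssumptionAWith)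

/-! ## The input `∑ ς²/n` with the exponent free: the reading `s₂ = E − 15` -/

/-- **The input of Lemma 3.6 with the exponent free** (the tree's subconvexity-free route): for every natural
`k` there is `C = C(k)` with `∑_{D⁴<n≤D⁸} ς(n)²/n ≤ C (log D)^{−k}` for every `D` with `log D ≥ 3` and every
PRIMITIVE `χ` mod `D` with `χ² = 1` and `‖L(1,χ)‖ ≤ (log D)^{−(k+15)}` (`ς = (ν·1_{≤D⁴}) ∗ (υ·1_{≤D⁴})`,
`sigmaTrunc (nuOf χ) (upsilonOf χ) D⁴`). The tree's `Lemma36Input.lemma_3_6_input` verbatim with Lemma 3.2♭ ↦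
its scale law at `k + 8` (the elementary factor `4(1 + log D⁴)⁸ ≤ 4·5⁸𝓛⁸`); the printed input is `k = 2007`.
[cite: Zhang2022LandauSiegel, §3, Lemma 3.2 + proof of Lemma 3.6 (the bound for ∑ ς(n)²/n), via the cell's variant A11] -/
theorem lemma36Input_scale_of_norm_le (k : ℕ) :
    ∃ C : ℝ, ∀ (D : ℕ) [NeZero D] (χ : DirichletCharacter ℂ D),
    χ.IsPrimitive → χ ^ 2 = 1 → 3 ≤ Real.log D →
    ‖χ.LFunction 1‖ ≤ 1 / Real.log D ^ (k + 15) →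
      ∑ n ∈ Ioc (D ^ 4) (D ^ 8),
        sigmaTrunc (nuOf (reChar χ)) (upsilonOf (reChar χ)) (D ^ 4) n ^ 2 / n ≤
          C / Real.log D ^ k := by
  obtain ⟨C₀, hC₀⟩ := lemma32Flat_scale_of_norm_le (k + 8)
  refine ⟨4 * 5 ^ 8 * max C₀ 0, ?_⟩
  intro D _ χ hprim hχ2 hL hA
  have hA' : ‖χ.LFunction 1‖ ≤ 1 / Real.log D ^ (k + 8 + 7) := by
    rw [show k + 8 + 7 = k + 15 by ring]; exact hA
  set Lg : ℝ := Real.log D with hLdef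
  have hL1 : 1 ≤ Lg := by linarith
  have hL0 : 0 < Lg := by linarith
  have hD0 : D ≠ 0 := by
    rintro rfl; simp [hLdef] at hL; linarith
  have hDpos : (0 : ℝ) < D := by exact_mod_cast Nat.pos_of_ne_zero hD0
  have hY : 1 ≤ D ^ 4 := Nat.one_le_pow _ _ (Nat.pos_of_ne_zero hD0)
  have e8 : D ^ 8 = D ^ 4 * D ^ 4 := by rw [← pow_add]
  rw [e8]
  -- the elementary reduction
  have hred := sum_sigma_sq_div_le_source_log_pow (reChar χ) (reChar_mul_all χ hχ2) (reChar_one χ)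
    (abs_reChar_le_one χ) hY
  -- the analytic input (Lemma 3.2♭ scale law) on `D⁴ < n ≤ D⁸`
  have hN : ((D ^ 4 * D ^ 4 : ℕ) : ℝ) ≤ (D : ℝ) ^ 8 := le_of_eq (by push_cast; ring)
  have hV := hC₀ D χ hprim hχ2 hL hA' (D ^ 4 * D ^ 4) hN
  have hVeq : ∑ n ∈ Ioc (D ^ 4) (D ^ 4 * D ^ 4), (n.divisors.card : ℝ) * nuOf (reChar χ) n ^ 2 / n =
      ∑ n ∈ Ioc (D ^ 4) (D ^ 4 * D ^ 4), ‖divisorSumChar χ n‖ ^ 2 * (n.divisors.card : ℝ) / n := by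
    refine sum_congr rfl fun n _ => ?_
    rw [nuOf_reChar_sq_eq χ hχ2]; ring
  rw [hVeq] at hred
  rw [← hLdef] at hV
  have hV' : ∑ n ∈ Ioc (D ^ 4) (D ^ 4 * D ^ 4), ‖divisorSumChar χ n‖ ^ 2 * (n.divisors.card : ℝ) / n ≤
      max C₀ 0 / Lg ^ (k + 8) :=
    hV.trans (div_le_div_of_nonneg_right (le_max_left _ _) (by positivity))
  -- the logarithmic factor `(1 + log D⁴)⁸ ≤ 5⁸ 𝓛⁸`
  have hlog : (1 + Real.log ((D ^ 4 : ℕ) : ℝ)) ^ 8 ≤ 5 ^ 8 * Lg ^ 8 := by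
    have e : Real.log ((D ^ 4 : ℕ) : ℝ) = 4 * Lg := by
      rw [Nat.cast_pow, Real.log_pow]; push_cast; rw [hLdef]
    rw [e]
    calc (1 + 4 * Lg) ^ 8 ≤ (5 * Lg) ^ 8 := pow_le_pow_left₀ (by positivity) (by linarith) 8
      _ = 5 ^ 8 * Lg ^ 8 := by ring
  have hmax : 0 ≤ max C₀ 0 := le_max_right _ _
  have hS0 : 0 ≤ ∑ n ∈ Ioc (D ^ 4) (D ^ 4 * D ^ 4),
      ‖divisorSumChar χ n‖ ^ 2 * (n.divisors.card : ℝ) / n :=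
    sum_nonneg fun n _ => by positivity
  have step2 : 4 * (1 + Real.log ((D ^ 4 : ℕ) : ℝ)) ^ 8 *
      ∑ n ∈ Ioc (D ^ 4) (D ^ 4 * D ^ 4), ‖divisorSumChar χ n‖ ^ 2 * (n.divisors.card : ℝ) / n ≤
      4 * (5 ^ 8 * Lg ^ 8) * (max C₀ 0 / Lg ^ (k + 8)) :=
    mul_le_mul (mul_le_mul_of_nonneg_left hlog (by norm_num)) hV' hS0 (by positivity)
  have e3 : 4 * (5 ^ 8 * Lg ^ 8) * (max C₀ 0 / Lg ^ (k + 8)) = 4 * 5 ^ 8 * max C₀ 0 / Lg ^ k := by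
    have : Lg ^ (k + 8) = Lg ^ k * Lg ^ 8 := pow_add _ _ _
    rw [this]
    field_simp
  exact hred.trans (step2.trans e3.le)

/-! ## The count with the exponents free: the reading `e₄ = (s₂ − 2) − 2τ₄` -/

/-- **Lemma 3.6 with the exponents free (sufficiency).** For natural `k`, `τ` there is `C = C(k)` such that
for every `D` with `log D ≥ 3` and every PRIMITIVE `χ` mod `D` with `χ² = 1` and `‖L(1,χ)‖ ≤ (log D)^{−(k+15)}`,
the number of `ψ ∈ Ψ` with `|X₄(D⁸,ψ)| + ∫_{D⁴}^{D⁸}|X₄(x,ψ)| dx/x ≥ 𝓛^{−τ}` (`Lemma36.lhs36`, = the left side of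
the skeleton's (3.6) by `Skeleton.lhs36_eq`) is `≤ C·𝔓·𝓛^{2+2τ}/𝓛^{k}`: orthogonality (`p ∼ P > D⁸`),
Cauchy–Schwarz in `dx/x` and Chebyshev (`Lemma36.lemma_3_6_of_input`: moment `≤ 34𝓛²𝔓·E`) over the input
scale law. [cite: Zhang2022LandauSiegel, §3, Lemma 3.6] -/
theorem lemma36_scale_of_norm_le (k τ : ℕ) :
    ∃ C : ℝ, ∀ (D : ℕ) [NeZero D] (χ : DirichletCharacter ℂ D),
    χ.IsPrimitive → χ ^ 2 = 1 → 3 ≤ Real.log D →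
    ‖χ.LFunction 1‖ ≤ 1 / Real.log D ^ (k + 15) →
      (({x : Chr D | (ell D ^ τ)⁻¹ ≤ Lemma36.lhs36 χ (s0 D) x.ψ}.ncard : ℕ) : ℝ) ≤
        C * frakP D * ell D ^ (2 + 2 * τ) / ell D ^ k := by
  classical
  obtain ⟨C, hC⟩ := lemma36Input_scale_of_norm_le k
  refine ⟨34 * C, fun D _ χ hp hχ2 hlog hA => ?_⟩
  have hD : 0 < D := Nat.pos_of_ne_zero (NeZero.ne D)
  have hs0 : (s0 D).re = 1 / 2 := by simp [s0, SmoothWeight.s0]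
  have hM : ∀ p ∈ primeWindow D, D ^ 8 < p := fun p hp' =>
    eight_pow_lt_of_mem_primeWindow hlog hp'
  have hE := hC D χ hp hχ2 hlog hA
  obtain ⟨-, hcount⟩ := Lemma36.lemma_3_6_of_input χ hD (by linarith) hE (s0 D) hs0 (primeWindow D) hM
  set L : ℝ := Real.log D with hLdef
  have hL0 : 0 < L := by linarith
  have hLne : L ≠ 0 := hL0.ne'
  -- Chebyshev at `V = 𝓛^{−τ}`
  have hV : 0 < (ell D ^ τ)⁻¹ := by rw [ell]; positivity
  have h2 := hcount ((ell D ^ τ)⁻¹) hV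
  -- the exceptional set embeds in the counted family
  set T : Finset ((p : ℕ) × DirichletCharacter ℂ p) := (primeWindow D).sigma fun p =>
    Finset.univ.filter fun ψ : DirichletCharacter ℂ p =>
      ψ.IsPrimitive ∧ (ell D ^ τ)⁻¹ ≤ Lemma36.lhs36 χ (s0 D) ψ with hTdef
  have hcard : {x : Chr D | (ell D ^ τ)⁻¹ ≤ Lemma36.lhs36 χ (s0 D) x.ψ}.ncard ≤ T.card := by
    rw [← Set.ncard_coe_finset]
    refine Set.ncard_le_ncard_of_injOn
      (fun x : Chr D => (⟨x.p, x.ψ⟩ : (p : ℕ) × DirichletCharacter ℂ p)) ?_ ?_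
      (Finset.finite_toSet T)
    · intro x hx
      rw [Set.mem_setOf_eq] at hx
      rw [Finset.mem_coe, hTdef, Finset.mem_sigma, Finset.mem_filter]
      exact ⟨x.mem, Finset.mem_univ _, x.prim, hx⟩
    · rintro ⟨p, hp', ψ, hψ⟩ _ ⟨p', hp'', ψ', hψ'⟩ _ h
      simp only [Sigma.mk.injEq] at h
      obtain ⟨rfl, h2⟩ := h
      simp only [heq_eq_eq] at h2
      subst h2
      rfl
  have hT : (T.card : ℝ) = ∑ p ∈ primeWindow D, ((Finset.univ.filter
      fun ψ : DirichletCharacter ℂ p =>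
        ψ.IsPrimitive ∧ (ell D ^ τ)⁻¹ ≤ Lemma36.lhs36 χ (s0 D) ψ).card : ℝ) := by
    rw [hTdef, Finset.card_sigma]; push_cast; rfl
  have h𝔓 : ∑ p ∈ primeWindow D, (p : ℝ) = frakP D := (frakP_eq_sum_primeWindow D).symm
  calc (({x : Chr D | (ell D ^ τ)⁻¹ ≤ Lemma36.lhs36 χ (s0 D) x.ψ}.ncard : ℕ) : ℝ) ≤ T.card := by
        exact_mod_cast hcard
    _ = _ := hT
    _ ≤ 34 * Real.log D ^ 2 * (∑ p ∈ primeWindow D, (p : ℝ)) * (C / Real.log D ^ k) /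
          ((ell D ^ τ)⁻¹) ^ 2 := h2
    _ = 34 * C * frakP D * ell D ^ (2 + 2 * τ) / ell D ^ k := by
        have hV2 : ((ell D ^ τ)⁻¹) ^ 2 = (L ^ (2 * τ))⁻¹ := by rw [ell, ← hLdef, inv_pow, pow_mul']
        rw [hV2, h𝔓, ell, ← hLdef, pow_add]
        field_simp

/-- **Lemma 3.6 with the exponents free, from `AssumptionAWith E`** (`E ≥ k + 15` real), in the skeleton's
`ForAllLarge` shape: for all large `D` and every real primitive `χ` mod `D`, `AssumptionAWith E D χ →
#{ψ ∈ Ψ : |X₄(D⁸,ψ)| + ∫|X₄| dx/x ≥ 𝓛^{−τ}} ≤ C·𝔓·𝓛^{2+2τ}/𝓛^{k}`. [cite: Zhang2022LandauSiegel, §3, Lemma 3.6] -/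
theorem lemma36_scale_of_assumptionAWith (k τ : ℕ) {E : ℝ} (hE : ((k + 15 : ℕ) : ℝ) ≤ E) :
    ∃ C : ℝ, ForAllLarge fun D _ χ => AssumptionAWith E D χ →
      (({x : Chr D | (ell D ^ τ)⁻¹ ≤ Lemma36.lhs36 χ (s0 D) x.ψ}.ncard : ℕ) : ℝ) ≤
        C * frakP D * ell D ^ (2 + 2 * τ) / ell D ^ k := by
  obtain ⟨C, hC⟩ := lemma36_scale_of_norm_le k τ
  refine ⟨C, ⌈Real.exp 3⌉₊, fun D _ χ hD hq hp hA => ?_⟩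
  have hlog : 3 ≤ Real.log D := by
    have h : Real.exp 3 ≤ D := le_trans (Nat.le_ceil _) (by exact_mod_cast hD)
    exact (Real.le_log_iff_exp_le (lt_of_lt_of_le (Real.exp_pos _) h)).mpr h
  exact hC D χ hp hq.sq_eq_one hlog (norm_le_pow_of_assumptionAWith χ (by linarith) hE hA)

/-- **At the printed threshold `τ = 633`** (the skeleton's (3.6), `Skeleton.Ineq36`): under `AssumptionAWith E`,
`E ≥ k + 15`, the inequality (3.6) fails for at most `C·𝔓·𝓛^{1268}/𝓛^{k}` characters `ψ ∈ Ψ`, `D` large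
(`1268 = 2 + 2·633`; the typed node `Skeleton.Lemma36` with `𝔓𝓛^{−739}` is the case `k = 2007`, `E ≥ 2022` —
the printed exponent, cf. `Skeleton.lemma36_holds`). [cite: Zhang2022LandauSiegel, §3, Lemma 3.6] -/
theorem not_ineq36_count_of_assumptionAWith (k : ℕ) {E : ℝ} (hE : ((k + 15 : ℕ) : ℝ) ≤ E) :
    ∃ C : ℝ, ForAllLarge fun D _ χ => AssumptionAWith E D χ →
      (({x : Chr D | ¬ Ineq36 χ x}.ncard : ℕ) : ℝ) ≤ C * frakP D * ell D ^ 1268 / ell D ^ k := by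
  obtain ⟨C, D₀, hC⟩ := lemma36_scale_of_assumptionAWith k 633 hE
  refine ⟨C, D₀, fun D _ χ hD hq hp hA => ?_⟩
  have h := hC D χ hD hq hp hA
  have hset : {x : Chr D | ¬ Ineq36 χ x} =
      {x : Chr D | (ell D ^ 633)⁻¹ ≤ Lemma36.lhs36 χ (s0 D) x.ψ} := by
    ext x; simp only [Set.mem_setOf_eq, ineq36_iff χ hq.sq_eq_one, not_lt]
  rw [hset]
  simpa using h

end Literature.NumberTheory.LFunctions.Zhang2022.Repair.Gap

end
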